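import Mathlib
import HarnessLib
import Literature.MathematicalPhysics.KineticTheory.VelocityFlipNoise
import Literature.MathematicalPhysics.KineticTheory.LangevinChainResolvent
import Summits.AtomisticToContinuum.FouriersLaw.Theorems.BondHeatUncertaintyLinearResponseFTURBondHeatVarianceContinuityHelper2
import Summits.AtomisticToContinuum.FouriersLaw.Theorems.VanishingNoiseTransferVanishingNoiseBoundFlipSteadyStateBind

/-!
# Exponential moments of the unique flip-steady family, UNIFORM in the bath temperatures

`--supports stmt-AtomisticToContinuum-11976` helper file (crux `VanishingNoiseBound`, route
`VanishingNoiseTransfer`, line `fekete-usc-one-length`, stub S3 `stub_noisyPositiveConductance`, wave 3).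
The mixing-free Kubo link of the velocity-flip chain passes to `δ → 0` along the unique flip-steady family
`μ_δ = μ_{N, T+δ/2, T−δ/2}` (fixed `N ≥ 2`, fixed flip rate `ε > 0`) by weak continuity, which needs tightness,
i.e. exponential moments `∫ e^{H/(2T)} dμ_δ ≤ M` UNIFORM in `|δ| ≤ T`. This file proves them, for the pinned chain
`pinnedChain ω₂ lam β γ` (all parameters `> 0`):

* `pinnedChain_exists_resolventKernel_uniform` — the resolvent kernel `R_r = ∫₀^∞ r e^{−rt} P_t dt` of the
  transition semigroup at temperatures `0 < T_L, T_R ≤ T_m`, with its resolvent identity on `C_c^∞`, the Feller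
  property and a CONTRACTING Lyapunov bound `∫ e^{θH} dR_r(z,·) ≤ a e^{θH(z)} + b` whose constants `a < 1`,
  `b < ∞` depend on the box `T_m` and on `θ < 1/T_m`, `r > 0` ONLY (the tree's `pinnedChain_exists_resolventKernel`,
  `LangevinChainResolvent.lean`, re-run around the box-uniform H2 threshold `uniformH2_small` of
  `…LinearResponseFTURBondHeatVarianceContinuityHelper2` instead of the fixed-temperature
  `pinnedChain_lintegral_exp_hamiltonian_small`; (3.4) is dominated monotonically by `C = 2θγT_m`).
* `flip_uniform_exp_moment` — hence, in S3's frame (a flip-steady family `μ` unique in `IsFlipSteadyState`,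
  `ε > 0`, `T > 0`, `N ≥ 2`): there is `M` with `∫ e^{H/(2T)} dμ_{N,T+δ/2,T−δ/2} ≤ M` for ALL `|δ| ≤ T` (the member is
  `π R_{Nε}` for the box-uniform kernel, `…FlipSteadyStateBind`, with `∫ e^{θH} dπ ≤ b/(1−a)`, by uniqueness).
* `helper_flipUniformExpMoment` — registered helper (notation-free restatement).

References: Cuneo–Eckmann–Hairer–Rey-Bellet 2018, Thm 5.1, Rem 5.2, §3 (3.4)–(3.6); Bernardin–Olla 2011 Prop. 1;
Hairer–Majda 2010 (uniform Lyapunov structure); folklore.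
-/

noncomputable section

open MeasureTheory ProbabilityTheory Filter Topology Set
open scoped NNReal ENNReal ContDiff BoundedContinuousFunction
open Literature.MathematicalPhysics.KineticTheory.HeatConduction Literature.Probability.Process OscillatorChain
open Summit.AtomisticToContinuum.FouriersLaw.Theorems.LinearResponseFTUR (uniformH2_small)

namespace Summit.AtomisticToContinuum.FouriersLaw.Theorems.VanishingNoiseBound

section Resolvent

variable {ω₂ lam β γ : ℝ} {N : ℕ}

/-- **Resolvent kernel of the pinned-chain transition semigroup with box-uniform Lyapunov constants**
(`ω₂, lam, β, γ > 0`, `N ≥ 2`, box `0 < T_L, T_R ≤ T_m`, rate `r > 0`, `0 < θ < 1/T_m`): there are `a < 1`,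
`b < ∞` such that for all temperatures in the box the kernel `R(z, ·) = ∫₀^∞ r e^{-rt} P_t(z, ·) dt` satisfies
(i) `∫ Lf dR(z, ·) = r (∫ f dR(z, ·) - f(z))` on `C_c^∞`, (ii) the Feller property, (iii)
`∫ e^{θH} dR(z, ·) ≤ a e^{θH(z)} + b`. (The tree's `pinnedChain_exists_resolventKernel` with the box-uniform H2
threshold `uniformH2_small`.) [cite: CuneoEckmannHairerReyBellet2018, Thm 5.1, Rem 5.2 and §3 eq. (3.4)–(3.6)] -/
theorem pinnedChain_exists_resolventKernel_uniform (hω : 0 < ω₂) (hl : 0 < lam) (hβ : 0 < β) (hγ : 0 < γ)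
    (hN : 1 < N) {Tm : ℝ} (hTm : 0 < Tm) {r : ℝ} (hr : 0 < r) {θ : ℝ} (hθ : 0 < θ) (hθm : θ < 1 / Tm) :
    ∃ a b : ℝ≥0∞, a < 1 ∧ b ≠ ⊤ ∧ ∀ (T_L T_R : ℝ), 0 < T_L → 0 < T_R → T_L ≤ Tm → T_R ≤ Tm →
      ∃ R : Kernel (PhaseSpace N) (PhaseSpace N), IsMarkovKernel R ∧
        (∀ f : PhaseSpace N → ℝ, ContDiff ℝ ∞ f → HasCompactSupport f → ∀ z : PhaseSpace N,
          ∫ y, (pinnedChain ω₂ lam β γ).generator N T_L T_R f y ∂(R z) = r * (∫ y, f y ∂(R z) - f z)) ∧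
        (∀ g : PhaseSpace N →ᵇ ℝ, Continuous fun z => ∫ y, g y ∂(R z)) ∧
        ∀ z : PhaseSpace N,
          ∫⁻ y, ENNReal.ofReal (Real.exp (θ * (pinnedChain ω₂ lam β γ).hamiltonian N y)) ∂(R z) ≤
            a * ENNReal.ofReal (Real.exp (θ * (pinnedChain ω₂ lam β γ).hamiltonian N z)) + b := by
  -- adapted from `pinnedChain_exists_resolventKernel` (Literature/…/LangevinChainResolvent.lean)
  have hN0 : 0 < N := by omega
  set P := pinnedChain ω₂ lam β γ
  -- box constants: `C = θγ(T_m + T_m)`, time step `t* = 1/(8(C + r + 1))`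
  set Cst : ℝ := θ * γ * (Tm + Tm) with hCst
  have hCst0 : 0 ≤ Cst := by positivity
  set ts : ℝ := 1 / (8 * (Cst + r + 1)) with hts
  have hts0 : 0 < ts := by positivity
  have hkey : (Cst + r + 1) * ts = 1 / 8 := by rw [hts]; field_simp
  have hCts : Cst * ts ≤ 1 / 8 := hkey ▸ mul_le_mul_of_nonneg_right (by linarith) hts0.le
  have hrts : r * ts ≤ 1 / 8 := hkey ▸ mul_le_mul_of_nonneg_right (by linarith) hts0.le
  set tstar : ℝ≥0 := ⟨ts, hts0.le⟩
  have htsco : ((tstar : ℝ≥0) : ℝ) = ts := rfl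
  have hts0' : (0 : ℝ≥0) < tstar := by rw [← NNReal.coe_lt_coe]; exact hts0
  set V : PhaseSpace N → ℝ≥0∞ := fun y => ENNReal.ofReal (Real.exp (θ * P.hamiltonian N y)) with hV
  have hVm : Measurable V := ENNReal.measurable_ofReal.comp (Real.measurable_exp.comp
    ((pinnedChain_continuous_hamiltonian ω₂ lam β γ N).measurable.const_mul _))
  -- the box-uniform H2 threshold (CEHR Thm 5.1 with contraction `1/2` at `t*`)
  obtain ⟨E₀, hE₀⟩ := uniformH2_small ω₂ lam β γ hω hl hβ hγ N hN Tm θ ts hTm hθ hθm hts0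
  set c₀ : ℝ := Real.exp (Cst * ts) * Real.exp (θ * E₀) with hc₀
  set a₀ : ℝ≥0∞ := ENNReal.ofReal (1 / 2) with ha₀
  have ha₀1 : a₀ < 1 := ENNReal.ofReal_lt_one.2 (by norm_num)
  set c : ℝ≥0∞ := ENNReal.ofReal (Real.exp (Cst * ts)) with hc
  obtain ⟨B, hBtop, hB⟩ := MarkovSemigroup.exists_fixedBound ha₀1 (ENNReal.ofReal_ne_top (r := c₀))
  refine ⟨c * ENNReal.ofReal (r * ts) + c * a₀, B + (c * ENNReal.ofReal c₀ + B), ?_, ?_, ?_⟩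
  · rw [hc, ha₀, ← ENNReal.ofReal_mul (Real.exp_pos _).le, ← ENNReal.ofReal_mul (Real.exp_pos _).le,
      ← ENNReal.ofReal_add (by positivity) (by positivity), ENNReal.ofReal_lt_one]
    have h1 : Real.exp (Cst * ts) * (1 - Cst * ts) ≤ 1 := by
      have := Real.add_one_le_exp (-(Cst * ts))
      calc Real.exp (Cst * ts) * (1 - Cst * ts) ≤ Real.exp (Cst * ts) * Real.exp (-(Cst * ts)) :=
            mul_le_mul_of_nonneg_left (by linarith) (Real.exp_pos _).le
        _ = 1 := by rw [← Real.exp_add, add_neg_cancel, Real.exp_zero]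
    nlinarith [Real.exp_pos (Cst * ts), mul_nonneg hCst0 hts0.le, mul_nonneg hr.le hts0.le]
  · exact ENNReal.add_ne_top.2 ⟨hBtop, ENNReal.add_ne_top.2
      ⟨ENNReal.mul_ne_top ENNReal.ofReal_ne_top ENNReal.ofReal_ne_top, hBtop⟩⟩
  intro T_L T_R hTL hTR hLm hRm
  set Sg := pinnedChainSemigroup hω hl.le hβ.le hγ.le hN0 hTL.le hTR.le
  haveI := isProbabilityMeasure_expMeasure hr
  set ρ := expMeasure r
  let K : Kernel (ℝ × PhaseSpace N) (PhaseSpace N) := ⟨fun p => Sg.kernel p.1.toNNReal p.2,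
    Measurable.comp (g := fun q : ℝ≥0 × PhaseSpace N => Sg.kernel q.1 q.2)
      (f := fun p : ℝ × PhaseSpace N => (p.1.toNNReal, p.2)) Sg.measurable_kernel (by fun_prop)⟩
  haveI hKM : IsMarkovKernel K :=
    ⟨fun p => by change IsProbabilityMeasure (Sg.kernel p.1.toNNReal p.2); infer_instance⟩
  have hK : ∀ (t : ℝ) (z : PhaseSpace N), K (t, z) = Sg.kernel t.toNNReal z := fun t z => rfl
  refine ⟨K ∘ₖ (Kernel.const (PhaseSpace N) ρ ×ₖ Kernel.id), inferInstance, fun f hf hfc z =>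
    Sg.integral_generator_comp_const_prod_id K hK (pinnedChain_contDiff_U ω₂ lam β γ)
      (pinnedChain_contDiff_V ω₂ lam β γ) hr hf hfc z, fun g => Sg.continuous_integral_comp_const_prod_id
      K hK ρ (continuous_act_pinnedChainSemigroup hω hl.le hβ.le hγ.le hN0 hTL.le hTR.le) g, ?_⟩
  -- (iii) on the box
  have hTmax : 0 < max T_L T_R := lt_max_of_lt_left hTL
  have hθ' : θ < 1 / max T_L T_R := hθm.trans_le (one_div_le_one_div_of_le hTmax (max_le hLm hRm))
  have hsum : θ * γ * (T_L + T_R) ≤ Cst := by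
    rw [hCst]; exact mul_le_mul_of_nonneg_left (add_le_add hLm hRm) (by positivity)
  have h34 : ∀ (t : ℝ≥0) (x : PhaseSpace N), ∫⁻ y, V y ∂(Sg.kernel t x) ≤
      ENNReal.ofReal (Real.exp (Cst * t) * Real.exp (θ * P.hamiltonian N x)) := by
    intro t x
    refine (lintegral_exp_mul_hamiltonian_pinnedChainSemigroup_le hω hl.le hβ.le hγ.le hN0 hTL.le
      hTR.le hTL hTR hθ hθ' t x).trans (ENNReal.ofReal_le_ofReal ?_)
    refine mul_le_mul_of_nonneg_right (Real.exp_le_exp.2 ?_) (Real.exp_pos _).le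
    exact mul_le_mul_of_nonneg_right hsum t.coe_nonneg
  have hH2 : ∀ x, ∫⁻ y, V y ∂(Sg.kernel tstar x) ≤ a₀ * V x + ENNReal.ofReal c₀ := by
    intro x
    change ∫⁻ y, V y ∂(P.transitionKernel N T_L T_R tstar x) ≤ _
    by_cases hx : P.hamiltonian N x ≤ E₀
    · refine (h34 tstar x).trans (le_add_left (ENNReal.ofReal_le_ofReal ?_))
      rw [hc₀, htsco]
      exact mul_le_mul_of_nonneg_left (Real.exp_le_exp.2 (mul_le_mul_of_nonneg_left hx hθ.le))
        (Real.exp_pos _).le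
    · rw [pinnedChain_lintegral_transitionKernel hω hl.le hβ.le hγ.le N T_L T_R tstar x hVm]
      refine (hE₀ T_L T_R hTL hTR hLm hRm x (le_of_not_ge hx)).trans (le_add_right (le_of_eq ?_))
      rw [ha₀, hV, ← ENNReal.ofReal_mul (by norm_num)]
      congr 1; ring
  have hloc : ∀ u : ℝ≥0, u < tstar → ∀ x, ∫⁻ y, V y ∂(Sg.kernel u x) ≤ c * V x := by
    intro u hu x
    refine (h34 u x).trans ?_
    rw [hc, hV, ← ENNReal.ofReal_mul (by positivity)]
    refine ENNReal.ofReal_le_ofReal (mul_le_mul_of_nonneg_right (Real.exp_le_exp.2 ?_) (by positivity))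
    have hu' : ((u : ℝ≥0) : ℝ) ≤ ts := by rw [← htsco]; exact_mod_cast hu.le
    nlinarith [u.coe_nonneg]
  -- the uniform orbit bound (3.5)–(3.6), and its sharpening past `t*`
  have hunif : ∀ (t : ℝ≥0) x, ∫⁻ y, V y ∂(Sg.kernel t x) ≤ c * V x + B := fun t x =>
    MarkovSemigroup.lintegral_kernel_le_of_lyapunov Sg.kernel Sg.kernel_zero Sg.kernel_add hVm hts0'
      ha₀1.le hB hH2 hloc t x
  intro z
  have h₁ : ∀ t : ℝ, ∫⁻ y, V y ∂(K (t, z)) ≤ c * V z + B := fun t => hunif t.toNNReal z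
  have h₂ : ∀ t : ℝ, ts ≤ t →
      ∫⁻ y, V y ∂(K (t, z)) ≤ c * a₀ * V z + (c * ENNReal.ofReal c₀ + B) := fun t ht =>
    Sg.lintegral_kernel_le_of_tstar_le K hK hVm hH2 hunif (by rw [htsco]; exact ht) z
  refine (lintegral_comp_const_prod_id_le K ρ z hVm ts h₁ h₂).trans ?_
  gcongr
  exact expMeasure_Iio_le hr hts0.le

end Resolvent

section Family

variable {ω₂ lam β γ : ℝ}

/-- **Exponential moments of the unique flip-steady family, uniform in `|δ| ≤ T`.** For the pinned chain (all
parameters `> 0`), a flip rate `ε > 0`, a flip-steady family `μ` unique in `IsFlipSteadyState`, `T > 0` and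
`N ≥ 2`: there is `M` such that for every `|δ| ≤ T` the member `μ N (T + δ/2) (T - δ/2)` integrates `e^{H/(2T)}`
with integral `≤ M` (the member is `π R_{Nε}` for the box-uniform resolvent kernel on `[T/2, 3T/2]²`, with
`∫ e^{θH} dπ ≤ b/(1−a)`, `…FlipSteadyStateBind`; uniqueness identifies it). [folklore] -/
theorem flip_uniform_exp_moment (hω : 0 < ω₂) (hl : 0 < lam) (hβ : 0 < β) (hγ : 0 < γ) {ε : ℝ} (hε : 0 < ε)
    (μ : (N : ℕ) → ℝ → ℝ → Measure (PhaseSpace N))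
    (hμ : ∀ (N : ℕ) (T_L T_R : ℝ), 0 < T_L → 0 < T_R →
      (pinnedChain ω₂ lam β γ).IsFlipSteadyState N T_L T_R ε (μ N T_L T_R) ∧
        ∀ ν : Measure (PhaseSpace N), (pinnedChain ω₂ lam β γ).IsFlipSteadyState N T_L T_R ε ν → ν = μ N T_L T_R)
    {T : ℝ} (hT : 0 < T) {N : ℕ} (hN : 2 ≤ N) :
    ∃ M : ℝ, ∀ δ : ℝ, |δ| ≤ T →
      Integrable (fun x => Real.exp (1 / (2 * T) * (pinnedChain ω₂ lam β γ).hamiltonian N x))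
          (μ N (T + δ / 2) (T - δ / 2)) ∧
        ∫ x, Real.exp (1 / (2 * T) * (pinnedChain ω₂ lam β γ).hamiltonian N x) ∂(μ N (T + δ / 2) (T - δ / 2)) ≤ M := by
  set P := pinnedChain ω₂ lam β γ with hP
  have hN1 : 1 < N := by omega
  have hN0 : 0 < N := by omega
  set Tm : ℝ := 3 * T / 2 with hTm
  have hTm0 : 0 < Tm := by positivity
  set θ : ℝ := 1 / (2 * T) with hθ
  have hθ0 : 0 < θ := by positivity
  have hθm : θ < 1 / Tm := by
    rw [hθ, hTm, div_lt_div_iff₀ (by positivity) (by positivity)]; nlinarith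
  have hr : (0 : ℝ) < (N : ℝ) * ε := by positivity
  obtain ⟨a, b, ha, hb, hbox⟩ :=
    pinnedChain_exists_resolventKernel_uniform (N := N) hω hl hβ hγ hN1 hTm0 hr hθ0 hθm
  -- the uniform bound `M = (a · b/(1−a) + b).toReal`
  set Mb : ℝ≥0∞ := a * (b / (1 - a)) + b with hMb
  have hMbtop : Mb ≠ ⊤ := by
    refine ENNReal.add_ne_top.2 ⟨ENNReal.mul_ne_top (ha.trans_le le_top).ne ?_, hb⟩
    exact ENNReal.div_ne_top hb (tsub_pos_of_lt ha).ne'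
  refine ⟨Mb.toReal, fun δ hδ => ?_⟩
  have hδ1 := abs_le.1 hδ
  have hTL : 0 < T + δ / 2 := by linarith
  have hTR : 0 < T - δ / 2 := by linarith
  have hLm : T + δ / 2 ≤ Tm := by rw [hTm]; linarith
  have hRm : T - δ / 2 ≤ Tm := by rw [hTm]; linarith
  obtain ⟨R, hRm', hres, hfel, hly⟩ := hbox _ _ hTL hTR hLm hRm
  haveI := hRm'
  obtain ⟨π, hπ, hsteady, hπV⟩ :=
    FixedLengthNoiseContinuity.exists_isFlipSteadyState_bind_of_resolventKernel hω hl.le hβ.le hN0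
      (T + δ / 2) (T - δ / 2) ε R hres hfel hθ0 ha hb hly
  have hid : μ N (T + δ / 2) (T - δ / 2) = π.bind R := ((hμ N _ _ hTL hTR).2 _ hsteady).symm
  have hVmeas : Measurable fun y : PhaseSpace N => ENNReal.ofReal (Real.exp (θ * P.hamiltonian N y)) :=
    ENNReal.measurable_ofReal.comp (Real.measurable_exp.comp
      ((pinnedChain_continuous_hamiltonian ω₂ lam β γ N).measurable.const_mul _))
  have hlint : ∫⁻ y, ENNReal.ofReal (Real.exp (θ * P.hamiltonian N y)) ∂(μ N (T + δ / 2) (T - δ / 2)) ≤ Mb := by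
    rw [hid]
    calc ∫⁻ y, ENNReal.ofReal (Real.exp (θ * P.hamiltonian N y)) ∂(π.bind R)
        ≤ a * ∫⁻ x, ENNReal.ofReal (Real.exp (θ * P.hamiltonian N x)) ∂π + b * π Set.univ :=
          MarkovChain.lintegral_bind_le_of_lyapunov R hVmeas hly π
      _ ≤ a * (b / (1 - a)) + b := by
          rw [measure_univ, mul_one]
          gcongr
  have hcont : Continuous fun z : PhaseSpace N => Real.exp (θ * P.hamiltonian N z) :=
    Real.continuous_exp.comp (continuous_const.mul (pinnedChain_continuous_hamiltonian ω₂ lam β γ N))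
  have hint : Integrable (fun x => Real.exp (θ * P.hamiltonian N x)) (μ N (T + δ / 2) (T - δ / 2)) := by
    refine ⟨hcont.aestronglyMeasurable, ?_⟩
    show ∫⁻ x, ‖Real.exp (θ * P.hamiltonian N x)‖ₑ ∂(μ N (T + δ / 2) (T - δ / 2)) < ⊤
    simp only [Real.enorm_eq_ofReal (Real.exp_nonneg _)]
    exact hlint.trans_lt hMbtop.lt_top
  refine ⟨hint, ?_⟩
  have hnn : 0 ≤ᵐ[μ N (T + δ / 2) (T - δ / 2)] fun x => Real.exp (θ * P.hamiltonian N x) :=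
    Eventually.of_forall fun x => (Real.exp_pos _).le
  rw [integral_eq_lintegral_of_nonneg_ae hnn hint.aestronglyMeasurable]
  exact ENNReal.toReal_mono hMbtop hlint

end Family

/-! ## Registered helper -/

/-- Registered helper sub-goal `helper_flipUniformExpMoment` of stub `stub_noisyPositiveConductance` (line
`fekete-usc-one-length`, crux stmt-AtomisticToContinuum-11976): uniform-in-`|δ| ≤ T` exponential moments
`∫ e^{H/(2T)} dμ_{N,T+δ/2,T−δ/2} ≤ M` of the unique flip-steady family (`flip_uniform_exp_moment`). -/
theorem helper_flipUniformExpMoment : ∀ (ω₂ lam β γ : ℝ), 0 < ω₂ → 0 < lam → 0 < β → 0 < γ → ∀ (ε : ℝ), 0 < ε → ∀ μ : (N : ℕ) → ℝ → ℝ → MeasureTheory.Measure (Literature.MathematicalPhysics.KineticTheory.HeatConduction.PhaseSpace N), (∀ (N : ℕ) (T_L T_R : ℝ), 0 < T_L → 0 < T_R → (Literature.MathematicalPhysics.KineticTheory.HeatConduction.pinnedChain ω₂ lam β γ).IsFlipSteadyState N T_L T_R ε (μ N T_L T_R) ∧ ∀ ν : MeasureTheory.Measure (Literature.MathematicalPhysics.KineticTheory.HeatConduction.PhaseSpace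 N), (Literature.MathematicalPhysics.KineticTheory.HeatConduction.pinnedChain ω₂ lam β γ).IsFlipSteadyState N T_L T_R ε ν → ν = μ N T_L T_R) → ∀ (T : ℝ), 0 < T → ∀ (N : ℕ), 2 ≤ N → ∃ M : ℝ, ∀ δ : ℝ, |δ| ≤ T → MeasureTheory.Integrable (fun x => Real.exp (1 / (2 * T) * (Literature.MathematicalPhysics.KineticTheory.HeatConduction.pinnedChain ω₂ lam β γ).hamiltonian N x)) (μ N (T + δ / 2) (T - δ / 2)) ∧ MeasureTheory.integral (μ N (T + δ / 2) (T - δ / 2)) (fun x => Real.exp (1 / (2 * T) * (Literature.MathematicalPhysics.KineticTheory.HeatConduction.pinnedChain ω₂ lam β γ).hamiltonian N x)) ≤ M :=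
  fun _ _ _ _ hω hl hβ hγ _ hε μ hμ _ hT _ hN => flip_uniform_exp_moment hω hl hβ hγ hε μ hμ hT hN

end Summit.AtomisticToContinuum.FouriersLaw.Theorems.VanishingNoiseBound

end
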